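import Mathlib
import Summits.AnomalousDissipation.AnomalousDissipation.Theorems.SoloBlindMonodromyTaylor

/-!
# The a-priori Taylor tail of the leaf monodromy from the plain log-norm (solo-blind s80, §24.90)

Kit j337423 measured, per box centre, the plain logarithmic-norm integral of the centre chain
generator `Λ = ∫₀ᵀ μ₂(Ã_c(t)) dt` (≈ 0.5·P: 7.3 at P = 16 … 33 at P = 64) and `F(T) = ∫₀ᵀ ‖Ã₁(t)‖₂ dt`
(= 1.14, P-independent).  The iterated Duhamel integrals with the two-time bound
`‖Φ_c(t,s)‖ ≤ exp(∫ₛᵗ μ₂)` (log-norm Grönwall, `s ≤ t`) telescope to ONE factor `e^Λ`: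
`‖M_j‖ ≤ e^Λ F(T)^j / j!`, so the degree-`d` Taylor tail on `|σ| ≤ s` is
`≤ e^Λ (sF)^{d+1} e^{sF} / (d+1)!` — small for `d ≈ 16–28` although `e^Λ` is `10³–10¹⁴`, because
`sF ≈ 1–2`.  With this tail the certified P-boxes reach the size allowed by the true variation of
`M` (half-widths 0.4–1.8 at J8, 1.8–4.9 at J16), whereas every instantaneous certificate stops at
0.02–0.1.  This file proves the real-analysis skeleton:

* `iterated_duhamel_bound_var` — time-VARIABLE interaction strength: from `g₀ ≤ G` and
  `g_{j+1}(t) ≤ ∫₀ᵗ a(s) g_j(s) ds` (`a ≥ 0` continuous, `F(t) = ∫₀ᵗ a`): `g_j(t) ≤ G F(t)^j/j!`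
  (generalises `iterated_duhamel_bound`, constant `a`);
* `lognorm_duhamel_bound` — the telescoped form: from `g₀(t) ≤ e^{m(t)}` and
  `g_{j+1}(t) ≤ ∫₀ᵗ e^{m(t) − m(s)} a(s) g_j(s) ds`: `g_j(t) ≤ e^{m(t)} F(t)^j/j!`;
* `taylor_tail_of_coeff_bound` — coefficient bounds `‖M_j‖ ≤ B F^j/j!` give the tail
  `Σ_{d<j<n} s^j ‖M_j‖ ≤ B (sF)^{d+1} e^{sF}/(d+1)!` [exp_tail_le].
-/

open Finset MeasureTheory Set intervalIntegral

namespace Summit.AnomalousDissipation.AnomalousDissipation.Theorems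

/-- FTC step: for continuous `a` and `F(t) = ∫₀ᵗ a`, `∫₀ᵗ a(s) F(s)^j ds = F(t)^{j+1}/(j+1)`. -/
theorem integral_mul_pow_primitive {a : ℝ → ℝ} (ha : Continuous a) (j : ℕ) (t : ℝ) :
    ∫ s in (0 : ℝ)..t, a s * (∫ u in (0 : ℝ)..s, a u) ^ j =
      (∫ u in (0 : ℝ)..t, a u) ^ (j + 1) / (j + 1) := by
  set F : ℝ → ℝ := fun s => ∫ u in (0 : ℝ)..s, a u with hF
  have hFd : ∀ x, HasDerivAt F (a x) x := fun x =>
    (ha.integral_hasStrictDerivAt 0 x).hasDerivAt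
  have hder : ∀ x ∈ uIcc (0 : ℝ) t,
      HasDerivAt (fun s => F s ^ (j + 1) / (j + 1)) (a x * F x ^ j) x := by
    intro x _
    have hj : ((j : ℝ) + 1) ≠ 0 := by positivity
    have h1 : HasDerivAt (fun s => F s ^ (j + 1)) (((j : ℝ) + 1) * F x ^ j * a x) x :=
      ((hFd x).pow (j + 1)).congr_deriv (by push_cast; simp)
    have h2 := h1.div_const ((j : ℝ) + 1)
    exact h2.congr_deriv (by rw [div_eq_iff hj]; ring)
  have hcontF : Continuous F := by
    have := (continuous_primitive (fun _ _ => ha.intervalIntegrable _ _) (0 : ℝ) (μ := volume))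
    simpa [F] using this
  have hint : IntervalIntegrable (fun x => a x * F x ^ j) volume 0 t :=
    (ha.mul (hcontF.pow j)).intervalIntegrable 0 t
  have := integral_eq_sub_of_hasDerivAt hder hint
  simp only [F] at this ⊢
  rw [this]
  simp

/-- **Iterated Duhamel bound, time-variable strength.**  `a ≥ 0` continuous, `F(t) = ∫₀ᵗ a`;
if `g 0 ≤ G` on `[0,T]` and `g (j+1) t ≤ ∫₀ᵗ a·g j` on `[0,T]` then `g j t ≤ G F(t)^j/j!` on
`[0,T]`. -/
theorem iterated_duhamel_bound_var (g : ℕ → ℝ → ℝ) {a : ℝ → ℝ} {G T : ℝ} (ha : Continuous a)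
    (ha0 : ∀ t, 0 ≤ a t)
    (hint : ∀ j, ∀ t ∈ Icc (0 : ℝ) T, IntervalIntegrable (fun s => a s * g j s) volume 0 t)
    (h0 : ∀ t ∈ Icc (0 : ℝ) T, g 0 t ≤ G)
    (hstep : ∀ j, ∀ t ∈ Icc (0 : ℝ) T, g (j + 1) t ≤ ∫ s in (0 : ℝ)..t, a s * g j s) :
    ∀ j, ∀ t ∈ Icc (0 : ℝ) T,
      g j t ≤ G * (∫ u in (0 : ℝ)..t, a u) ^ j / (Nat.factorial j : ℝ) := by
  intro j
  induction j with
  | zero => intro t ht; simpa using h0 t ht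
  | succ j ih =>
    intro t ht
    have ht0 : 0 ≤ t := ht.1
    have htT : t ≤ T := ht.2
    refine (hstep j t ht).trans ?_
    have hcontF : Continuous fun s : ℝ => ∫ u in (0 : ℝ)..s, a u := by
      have := (continuous_primitive (fun _ _ => ha.intervalIntegrable _ _) (0 : ℝ) (μ := volume))
      simpa using this
    have hbi : IntervalIntegrable
        (fun s => a s * (G * (∫ u in (0 : ℝ)..s, a u) ^ j / (Nat.factorial j : ℝ))) volume 0 t :=
      ((ha.mul ((continuous_const.mul (hcontF.pow j)).div_const _))).intervalIntegrable 0 t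
    calc ∫ s in (0 : ℝ)..t, a s * g j s
        ≤ ∫ s in (0 : ℝ)..t, a s * (G * (∫ u in (0 : ℝ)..s, a u) ^ j / (Nat.factorial j : ℝ)) := by
          apply integral_mono_on ht0 (hint j t ht) hbi
          intro s hs
          exact mul_le_mul_of_nonneg_left (ih s ⟨hs.1, hs.2.trans htT⟩) (ha0 s)
      _ = G / (Nat.factorial j : ℝ) * ∫ s in (0 : ℝ)..t, a s * (∫ u in (0 : ℝ)..s, a u) ^ j := by
          rw [← intervalIntegral.integral_const_mul]
          congr 1; funext s; ring
      _ = G * (∫ u in (0 : ℝ)..t, a u) ^ (j + 1) / (Nat.factorial (j + 1) : ℝ) := by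
          rw [integral_mul_pow_primitive ha j t, Nat.factorial_succ, Nat.cast_mul, Nat.cast_succ]
          have hj : (Nat.factorial j : ℝ) ≠ 0 := by positivity
          have hj1 : ((j : ℝ) + 1) ≠ 0 := by positivity
          field_simp

/-- **Log-norm telescoping.**  If `g 0 t ≤ e^{m(t)}` and
`g (j+1) t ≤ ∫₀ᵗ e^{m(t) − m(s)} a(s) g j (s) ds` on `[0,T]` (two-time propagator bound
`‖Φ_c(t,s)‖ ≤ e^{m(t) − m(s)}`, `m(t) = ∫₀ᵗ μ₂`), then `g j t ≤ e^{m(t)} F(t)^j/j!`: the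
exponential appears ONCE, not `j+1` times. -/
theorem lognorm_duhamel_bound (g : ℕ → ℝ → ℝ) (m : ℝ → ℝ) {a : ℝ → ℝ} {T : ℝ}
    (ha : Continuous a) (ha0 : ∀ t, 0 ≤ a t)
    (hint : ∀ j, ∀ t ∈ Icc (0 : ℝ) T,
      IntervalIntegrable (fun s => a s * (Real.exp (-m s) * g j s)) volume 0 t)
    (h0 : ∀ t ∈ Icc (0 : ℝ) T, g 0 t ≤ Real.exp (m t))
    (hstep : ∀ j, ∀ t ∈ Icc (0 : ℝ) T,
      g (j + 1) t ≤ ∫ s in (0 : ℝ)..t, Real.exp (m t - m s) * a s * g j s) :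
    ∀ j, ∀ t ∈ Icc (0 : ℝ) T,
      g j t ≤ Real.exp (m t) * (∫ u in (0 : ℝ)..t, a u) ^ j / (Nat.factorial j : ℝ) := by
  -- apply the variable-strength lemma to h j t := e^{-m t} g j t with G = 1
  set h : ℕ → ℝ → ℝ := fun j t => Real.exp (-m t) * g j t with hh
  have hpos : ∀ t, 0 < Real.exp (m t) := fun t => Real.exp_pos _
  have h0' : ∀ t ∈ Icc (0 : ℝ) T, h 0 t ≤ 1 := by
    intro t ht
    have := h0 t ht
    simp only [hh]
    rw [Real.exp_neg]
    calc (Real.exp (m t))⁻¹ * g 0 t ≤ (Real.exp (m t))⁻¹ * Real.exp (m t) :=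
          mul_le_mul_of_nonneg_left this (inv_nonneg.mpr (hpos t).le)
      _ = 1 := inv_mul_cancel₀ (hpos t).ne'
  have hstep' : ∀ j, ∀ t ∈ Icc (0 : ℝ) T, h (j + 1) t ≤ ∫ s in (0 : ℝ)..t, a s * h j s := by
    intro j t ht
    have hs := hstep j t ht
    simp only [hh]
    have hrw : (fun s => Real.exp (m t - m s) * a s * g j s) =
        fun s => Real.exp (m t) * (a s * (Real.exp (-m s) * g j s)) := by
      funext s; rw [Real.exp_sub, Real.exp_neg]; ring
    rw [hrw, intervalIntegral.integral_const_mul] at hs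
    rw [Real.exp_neg]
    calc (Real.exp (m t))⁻¹ * g (j + 1) t
        ≤ (Real.exp (m t))⁻¹ * (Real.exp (m t) * ∫ s in (0 : ℝ)..t, a s * (Real.exp (-m s) * g j s)) :=
          mul_le_mul_of_nonneg_left hs (inv_nonneg.mpr (hpos t).le)
      _ = ∫ s in (0 : ℝ)..t, a s * (Real.exp (-m s) * g j s) := by
          rw [← mul_assoc, inv_mul_cancel₀ (hpos t).ne', one_mul]
  have key := iterated_duhamel_bound_var h ha ha0 hint h0' hstep'
  intro j t ht
  have hk := key j t ht
  simp only [hh, one_mul] at hk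
  rw [Real.exp_neg] at hk
  have := mul_le_mul_of_nonneg_left hk (hpos t).le
  rw [← mul_assoc, mul_inv_cancel₀ (hpos t).ne', one_mul] at this
  calc g j t ≤ Real.exp (m t) * ((∫ u in (0 : ℝ)..t, a u) ^ j / (Nat.factorial j : ℝ)) := this
    _ = Real.exp (m t) * (∫ u in (0 : ℝ)..t, a u) ^ j / (Nat.factorial j : ℝ) := by ring

/-- **Tail of the Taylor series from coefficient bounds.**  If `c j ≤ B F^j/j!` (`B, F, s ≥ 0`),
then `Σ_{d<j<n} s^j c j ≤ B (sF)^{d+1} e^{sF}/(d+1)!`. -/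
theorem taylor_tail_of_coeff_bound (c : ℕ → ℝ) {B F s : ℝ} (hB : 0 ≤ B) (hF : 0 ≤ F)
    (hs : 0 ≤ s) (hc : ∀ j, c j ≤ B * F ^ j / (Nat.factorial j : ℝ)) (d n : ℕ) :
    ∑ j ∈ Ico (d + 1) n, s ^ j * c j ≤
      B * ((s * F) ^ (d + 1) / (Nat.factorial (d + 1) : ℝ) * Real.exp (s * F)) := by
  calc ∑ j ∈ Ico (d + 1) n, s ^ j * c j
      ≤ ∑ j ∈ Ico (d + 1) n, B * ((s * F) ^ j / (Nat.factorial j : ℝ)) := by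
        refine Finset.sum_le_sum fun j _ => ?_
        calc s ^ j * c j ≤ s ^ j * (B * F ^ j / (Nat.factorial j : ℝ)) :=
              mul_le_mul_of_nonneg_left (hc j) (pow_nonneg hs _)
          _ = B * ((s * F) ^ j / (Nat.factorial j : ℝ)) := by rw [mul_pow]; ring
    _ = B * ∑ j ∈ Ico (d + 1) n, (s * F) ^ j / (Nat.factorial j : ℝ) := by rw [Finset.mul_sum]
    _ ≤ B * ((s * F) ^ (d + 1) / (Nat.factorial (d + 1) : ℝ) * Real.exp (s * F)) :=
        mul_le_mul_of_nonneg_left (exp_tail_le (mul_nonneg hs hF) d n) hB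

end Summit.AnomalousDissipation.AnomalousDissipation.Theorems
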